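/-
Copyright: lit-balaban cell, Phase-2 proof seat p11 (gen 4).  Skeleton of a published paper; no claims beyond what the kernel checks.
-/
import Literature.MathematicalPhysics.QuantumFieldTheory.BalabanImbrieJaffe1984to88.BIJ85FluctuationCovarianceFlatBounds

/-!
# `BalabanImbrieJaffe1984to88.BIJ85FluctuationCovariancePureGauge` — T. Bałaban, J. Imbrie, A. Jaffe, *Renormalization of the Higgs
model: minimizers, propagators and the stability of mean field theory*, Commun. Math. Phys. **97** (1985) 299–329 [BalabanImbrieJaffe1985],
p. 301 *"uniform stability estimates (strictly positive lower bounds)"* for the scalar fluctuation form of Sect. 4.6 p. 313, i.e. [3] =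
[Balaban1982Higgs1] Prop. 2.3 **(2.33) `γ₀I ≤ a′P + Δ_k` — EXTENDED FROM THE FLAT BACKGROUND (gen 4's `BIJ85FluctuationCovarianceFlatBounds`)
TO EVERY PURE-GAUGE BACKGROUND `u = 1^h`** on the torus model of record, with the SAME explicit `γ₀ = γ₀(a, a′, d, L)`, uniform in `k ≥ 1`,
`j`, the volume and the gauge transformation `h` — by the gauge covariance (2.8)/(6.3.2) of the explicit forms (gen 3's
`BIJ85ScalarPropagatorTorusK.inner_deltaOp_gaugeAct`, r18's `lineIter_gaugeAct`/`qCov_gaugeAct`).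

statement-level skeleton of published theorems with citation tags; proofs where landed; nothing here is a claim about the Yang–Mills mass gap

PDF held: `paper:balaban1985-cmp97-bij-higgs-minimizers` (journal page = PDF page + 298), pp. 301, 303, 313, 320; [3] =
`paper:balaban1982-cmp85-higgs23-i` (journal page = PDF page + 602), p. 611 [PDF 9].

CITATION HEADER (lean-in-tree rule).  Phase-2 file of the lit-balaban TYPED SKELETON (HOME `run/shared/lean/pub/lit-balaban/`), seat p11 gen 4
(unit `lit-balaban-p11-g4`; owner r15, referee ref-5; own lane = the C1 scalar sector §4.6).  WHAT IS REPRODUCED: row **C1.Eq4.6.2-4.6.4** /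
**C1.Eq1.4** (p. 301 prose) KNITTED with row **B1.Prop2.3** (2.33) (owner r14) — kind «model-instance», the pure-gauge orbit of the flat case
(as gen 4 did for (7.3.2): `BIJ85Ineq732Flat.ineq732_pureGauge`).  No decl of record restated.

THE PRINTED TEXT, verbatim.  C1 p. 301 [PDF 3]: *"… and establish uniform stability estimates (strictly positive lower bounds) on the S_Q's."*
p. 303 [PDF 5]: *"Clearly (Qφ)^h = Qφ^h. (2.8)"*  p. 320 [PDF 22]: *"S_k(u_ke^{−iη∂λ}, e^{iλ}φ) = S_k(u_k, φ) (6.3.2) … it is clear in the case of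
the quadratic forms for which we write explicit formulas."*  [3] p. 611 [PDF 9]: *"γ₀I ≤ aL^{−2}P(A) + Δ^{(k)}(Ω, A) ≤ γ₁I, (2.33)"*.

WHAT IS PROVED (0 `sorry`, standard axioms; theorems only).
* `norm_twist_eq` / `norm_Qlin_twist_eq`: `‖hψ‖ = ‖ψ‖` and `‖Q((1^h)^{(k)})(hψ)‖ = ‖Q(1)ψ‖` (the unit-lattice transformation read at the
  corner points; (2.8) at level `k`: r18's `lineIter_gaugeAct`, `qCov_gaugeAct`, gen 4's `lineIter_one`).
* **`coercive_pureGauge`**: for every gauge transformation `h` of the `η`-lattice, `u := 1^h`, `k ≥ 1`, `j + k + 1 ≤ m + K`, `a, a′ > 0` and THE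
  inverse `G_k(u)` of (4.6.2): `γ₀‖ψ‖² ≤ a′‖Q(u^{(k)})ψ‖² + ⟨ψ, Δ_k(u)ψ⟩` for all `ψ`, `γ₀ = BIJ85FluctuationCovarianceFlatBounds.gamma0 a a′ d L`
  (gen 4's `coercive_flat` transported along `ψ ↦ hψ` by gen 3's `inner_deltaOp_gaugeAct`); `coercive_covOp_pureGauge`: the same for
  `⟨ψ, (a′Q(u^{(k)})^*Q(u^{(k)}) + Δ_k(u))ψ⟩` (gen 4's `covOp`), i.e. (2.33)'s lower bound for `C^{(k)}(u)^{−1}` at `u = 1^h`.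
HONEST SCOPE.  Pure-gauge backgrounds only (the general regular background of Prop. 2.3 / (7.3.1) is not claimed: GAPS G-C1-05); the upper
bound of (2.33) at EVERY background is gen 4's `form_le`.
-/

open scoped RealInnerProductSpace BigOperators
open Finset

namespace Literature.MathematicalPhysics.QuantumFieldTheory.BalabanImbrieJaffe1984to88.BIJ85FluctuationCovariancePureGauge

open Literature.MathematicalPhysics.QuantumFieldTheory.Balaban1983to89
open BIJ88Sect3Statements (U1 toC cfg covD norm_toC)
open BIJ85Sect1Model (HiggsField)
open BIJ85BlockAveragesTorus BIJ85BlockAveragesTorusK BIJ85ScalarPropagatorTorus BIJ85ScalarPropagatorTorusK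
open BIJ85ScalarForm464 BIJ85Eq461Proof BIJ85BlockAveragingIneq BIJ85Ineq732Flat BIJ85FluctuationCovariance
open BIJ85FluctuationCovarianceFlatBounds
open GaugeField (gaugeAct)

noncomputable section

variable {P : Params} {i j : ℕ}

/-- kernel: `‖hψ‖ = ‖ψ‖` for a `U(1)`-valued multiplier read at any points (`|h| = 1`). [cite: BalabanImbrieJaffe1985, (2.7) p.303] -/
theorem norm_twist_eq (g : Balaban1983to89.Site P i → U1) (ψ ψ' : PiLp 2 (fun _ : Balaban1983to89.Site P i => ℂ))
    (hψ' : ∀ y, ψ' y = toC (g y) * ψ y) : ‖ψ'‖ ^ 2 = ‖ψ‖ ^ 2 := by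
  rw [← sum_norm_sq_eq ψ', ← sum_norm_sq_eq ψ]
  exact sum_congr rfl fun y _ => by rw [hψ', norm_mul, norm_toC, one_mul]

/-- **(2.8) at level `k` for the pure-gauge background, in norm**: with `u = 1^h`, `u^{(k)} = 1^{h∘corner_k}` (r18's `lineIter_gaugeAct`,
gen 4's `lineIter_one`) and `‖Q(u^{(k)})(hψ)‖ = ‖Q(1)ψ‖` (`qCov_gaugeAct`, `|h| = 1`). [cite: BalabanImbrieJaffe1985, (2.8) p.303] -/
theorem norm_Qlin_twist_eq {k : ℕ} (hk : j + k + 1 ≤ P.m + P.K) (h : GaugeTransf P j U1) (ψ ψ' : CoarseSpK P j k)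
    (hψ' : ∀ y, ψ' y = toC (h (cornerIter k y)) * ψ y) :
    ‖Qlin (lineIter (gaugeAct h (1 : GaugeField P j U1)) k) ψ'‖ ^ 2 = ‖Qlin (1 : GaugeField P (j+k) U1) ψ‖ ^ 2 := by
  rw [lineIter_gaugeAct h 1 k (by omega), lineIter_one, ← sum_norm_sq_eq (Qlin _ ψ'), ← sum_norm_sq_eq (Qlin _ ψ)]
  refine sum_congr rfl fun y _ => ?_
  have e : WithLp.ofLp ψ' = fun x => toC (h (cornerIter k x)) * (WithLp.ofLp ψ) x := funext fun x => hψ' x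
  rw [Qlin_apply, Qlin_apply, e, qCov_gaugeAct (j := j + k) hk (fun x => h (cornerIter k x)) 1 (WithLp.ofLp ψ) y, norm_mul, norm_toC,
    one_mul]

/-- **(2.33), LOWER BOUND, AT EVERY PURE-GAUGE BACKGROUND `u = 1^h`** on the torus: for `k ≥ 1`, `j + k + 1 ≤ m + K`, `a, a′ > 0`, every gauge
transformation `h`, `G′ = G_k(1^h)` the inverse of (4.6.2), and every unit-lattice field `ψ`:
`γ₀‖ψ‖² ≤ a′‖Q((1^h)^{(k)})ψ‖² + ⟨ψ, Δ_k(1^h)ψ⟩`, `γ₀ = gamma0 a a′ d L` as at the flat background — gen 4's `coercive_flat` at `h^{−1}ψ`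
transported by the covariance (6.3.2)/(2.8) of the explicit forms. [cite: Balaban1982Higgs1, (2.33) p.611] -/
theorem coercive_pureGauge {k : ℕ} (hk1 : 1 ≤ k) (hk : j + k + 1 ≤ P.m + P.K) {a a' : ℝ} (ha : 0 < a) (ha' : 0 < a')
    (h : GaugeTransf P j U1) {G' : FineSp P j →ₗ[ℝ] FineSp P j}
    (hG' : ∀ φ, opT (Dlin (cPhys P k) (gaugeAct h (1 : GaugeField P j U1))) (QlinK (gaugeAct h (1 : GaugeField P j U1)) k)
      (BIJ85Sect4Statements.aK a P.L k) (G' φ) = φ)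
    (ψ' : CoarseSpK P j k) :
    gamma0 a a' P.d P.L * ‖ψ'‖ ^ 2
      ≤ a' * ‖Qlin (lineIter (gaugeAct h (1 : GaugeField P j U1)) k) ψ'‖ ^ 2
        + ⟪ψ', deltaOp (QlinK (gaugeAct h (1 : GaugeField P j U1)) k) (BIJ85Sect4Statements.aK a P.L k) G' ψ'⟫ := by
  have hL : (1 : ℝ) < P.L := by linarith [three_le_L P]
  have hα := (BIJ85CoefficientAk464.aK_pos_le ha hL hk1).1
  obtain ⟨G, hG, -⟩ := exists_GK (k := k) (by omega) (cPhys_pos P k).ne' hα (1 : GaugeField P j U1)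
  set ψ : CoarseSpK P j k := WithLp.toLp 2 (fun y => (toC (h (cornerIter k y)))⁻¹ * ψ' y) with hψ
  have hψ' : ∀ y, ψ' y = toC (h (cornerIter k y)) * ψ y := fun y => by
    show ψ' y = toC (h (cornerIter k y)) * ((toC (h (cornerIter k y)))⁻¹ * ψ' y)
    rw [mul_inv_cancel_left₀ (toC_ne_zero _)]
  rw [inner_deltaOp_gaugeAct (by omega) (cPhys P k) hα.le h 1 hG hG' hψ', norm_Qlin_twist_eq hk h ψ ψ' hψ',
    norm_twist_eq (fun y => h (cornerIter k y)) ψ ψ' hψ']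
  exact coercive_flat hk1 hk ha ha' hG ψ

/-- **… for the operator of [3] (2.31) at `u = 1^h`**: `γ₀‖ψ‖² ≤ ⟨ψ, (a′Q(u^{(k)})^*Q(u^{(k)}) + Δ_k(u))ψ⟩` (gen 4's `covOp`), so its inverse
`C^{(k)}(1^h)` obeys `C^{(k)} ≤ γ₀^{−1}` in form sense with the flat `γ₀`. [cite: Balaban1982Higgs1, (2.33) p.611] -/
theorem coercive_covOp_pureGauge {k : ℕ} (hk1 : 1 ≤ k) (hk : j + k + 1 ≤ P.m + P.K) {a a' : ℝ} (ha : 0 < a) (ha' : 0 < a')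
    (h : GaugeTransf P j U1) {G' : FineSp P j →ₗ[ℝ] FineSp P j}
    (hG' : ∀ φ, opT (Dlin (cPhys P k) (gaugeAct h (1 : GaugeField P j U1))) (QlinK (gaugeAct h (1 : GaugeField P j U1)) k)
      (BIJ85Sect4Statements.aK a P.L k) (G' φ) = φ)
    (ψ' : CoarseSpK P j k) :
    gamma0 a a' P.d P.L * ‖ψ'‖ ^ 2
      ≤ ⟪ψ', covOp (QlinK (gaugeAct h (1 : GaugeField P j U1)) k) (BIJ85Sect4Statements.aK a P.L k) G'
          (Qlin (lineIter (gaugeAct h (1 : GaugeField P j U1)) k)) a' ψ'⟫ := by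
  rw [inner_covOp]
  exact coercive_pureGauge hk1 hk ha ha' h hG' ψ'

end

end Literature.MathematicalPhysics.QuantumFieldTheory.BalabanImbrieJaffe1984to88.BIJ85FluctuationCovariancePureGauge
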